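import Summits.RiemannHypothesis.RiemannHypothesis.Theorems.WeilFormatCDataLog3HalfColSlice0
import Summits.RiemannHypothesis.RiemannHypothesis.Theorems.WeilFormatCDataLog3HalfFrontData
import HarnessLib

/-!
# Format C kernel rung `Log3Half` (a = (log 3)/2): front-door constants, far-diagonal endpoints, the constant even weight w = 1384501848287·2^-40 and the tail bases (kernel certificates; blocks B = 25/24, B₃ = 64/64)

Window `a = (log 3)/2`; prime powers in the window: 2; evaluator parameters S = 2^80, Kpi 70, Kser 96, kred 8, Kexp 24, J 60; full table modes < 34; light column table modes < 131; units 2^-80 (entries), 2^-40 (weights).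
Generated by rh-explicit-weil-2 gen5 (gen/gramgen.py + emit5.py) from `#eval` of the tree's `Encl` functions; every datum is re-verified by the kernel in the theorem files (`decide +kernel`: recompute + containment). Helper data of the rh-explicit Weil-positivity programme (format C, K-CELL-2 CAL rung), RH-free. [cite: Yoshida1992HermitianForms, §5 (5.15)-(5.16) p. 301; §7 pp. 305–312]
-/

set_option linter.dupNamespace false
set_option maxRecDepth 200000

namespace Summit.RiemannHypothesis.RiemannHypothesis.Theorems.WeilFormatCData.Log3Half
open Literature.NumberTheory.LFunctions Literature.NumberTheory.LFunctions.Yoshida1992 Encl Literature.Analysis.ValidatedNumerics.NumericsMP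

/-- kernel: the front-door constants (and floors) are valid. -/
theorem tF : checkFDConsts prm C 1 ns F = true := by decide +kernel

/-- the front-door constants are valid for `a`. -/
theorem fd_valid : FDValid (2 ^ 80) a F :=
  fdValid_of_check (prm := prm) (ks := ks) (by norm_num [prm]) primeData consts_valid tF

/-- kernel: `√(8/(Be−1)) ≤ 605397/1048576`. -/
theorem tSqE : checkSqrtUpper 8 (25 - 1) 605397 1048576 = true := by decide +kernel

/-- kernel: `√(8/Bo) ≤ 605397/1048576`. -/
theorem tSqO : checkSqrtUpper 8 24 605397 1048576 = true := by decide +kernel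

/-- kernel: `0 < d̂⁺(25)` (box endpoint). -/
theorem t0E : 0 < (devEvenBox (2 ^ 80) C F (tget tab 25) 25 605397 1048576).lo := by decide +kernel

/-- kernel: the even weight `w = 1384501848287·2^-40 ≤ d̂⁺(25)`. -/
theorem tWE : (1384501848287 : ℤ) * ((2 ^ 80 : ℕ) : ℤ) ≤ (devEvenBox (2 ^ 80) C F (tget tab 25) 25 605397 1048576).lo * 2 ^ 40 := by decide +kernel

/-- kernel: the even tail base `d₀ = 1904764190903·2^-40 ≤ d̂⁺(64)`. -/
theorem tDE : (1904764190903 : ℤ) * ((2 ^ 80 : ℕ) : ℤ) ≤ (devEvenBox (2 ^ 80) C F (tget ctab 64) 64 605397 1048576).lo * 2 ^ 40 := by decide +kernel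

/-- kernel: `0 < core⁻(24) − π/4 − …` (box endpoint). -/
theorem t0O : 0 < (devOddBox (2 ^ 80) C F (tget ctab (24 + 1)) 24 24 605397 1048576).lo := by decide +kernel

/-- kernel: the odd tail base `d₀ = 1048978184635·2^-40`. -/
theorem tDO : (1048978184635 : ℤ) * ((2 ^ 80 : ℕ) : ℤ) ≤ (devOddBox (2 ^ 80) C F (tget ctab (64 + 1)) 64 24 605397 1048576).lo * 2 ^ 40 := by decide +kernel

end Summit.RiemannHypothesis.RiemannHypothesis.Theorems.WeilFormatCData.Log3Half
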